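import Mathlib
import Summits.ValiantsHypothesis.ValiantsHypothesis.Theses.NewtonUnitEquations
import Literature.Computability.AlgebraicComplexity.NewtonPolygonTau
import Literature.Computability.AlgebraicComplexity.NewtonPolygonTauProductBounds
import Summits.ValiantsHypothesis.ValiantsHypothesis.Theorems.NewtonUnitEquationsTwoProductsMahlerRadixRecursionDefs
import Summits.ValiantsHypothesis.ValiantsHypothesis.Theorems.NewtonUnitEquationsTwoProductsMahlerRadixRecursionStubOuterVertices

/-!
# Crux `TwoProducts` (stmt-ValiantsHypothesis-5906), line `mahler-radix-recursion`: the two reductions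

The registered line `Cruxes/TwoProducts/Lines/mahler-radix-recursion.lean` (induction on scales; NOT the item's
skeleton of record) has two compositions, kernel-checked in the skeleton modulo its stubs:

* `TwoProducts_of`: STUB (α) `OuterVertices` + STUB (β) `HiddenVertices` (the weak multiplicative SCALE STEP, the
  line's OPEN core) ⇒ the crux `TwoProducts`, by the recursion `V(m+1) ≤ (2^a+1)·V(m) + (m+3)t + (m+t+2)^c`;
* `radixTwoProducts_of`: STUB (β_r) `RadixScaleStep` (the OPEN regime engine) ⇒ the regime target
  `RadixTwoProducts` (polynomial bound for radix frames, uniform in the base), by Mahler's functional equation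
  (the coarse pair of a radix frame is `expand b` of the shifted instance) and the additive recursion.

With (α) now a theorem of the tree (`stub_outerVertices`, file `…MahlerRadixRecursionStubOuterVertices.lean`), this
file lands BOTH compositions over the objects of `Theorems/NewtonUnitEquationsTwoProductsMahlerRadixRecursionDefs.lean`
with the open stubs as INLINE hypotheses stated VERBATIM (no definition introduced):

* `twoProducts_of_hiddenVertices : (HiddenVertices body) → TwoProducts` (constants `a + c + 4`, `2c + 4`);
* `radixTwoProducts_of_radixScaleStep : (RadixScaleStep body) → (RadixTwoProducts body)` (exponent `κ + 4`).

The proofs are the skeleton's (`vert_le_F`, `F_le`, `F_bound`; `vert_expand`, `coarseDiff_radix_zero`,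
`vert_radix_le_H`, `H_bound`), here sorry-free.

Honest framing: CONDITIONAL reductions on a registered non-record line; (β) and (β_r) are OPEN and NOT claimed; the
crux `TwoProducts` stays OPEN; nothing here bears on `VP ≠ VNP`.
-/

set_option linter.dupNamespace false

noncomputable section

open scoped BigOperators
open MvPolynomial Literature.Computability.AlgebraicComplexity

namespace Summit.ValiantsHypothesis.ValiantsHypothesis.Theorems.NewtonUnitEquations.TwoProducts.MahlerRadixRecursion


/-- A lattice polygon has at most as many vertices as generating points. [folklore] -/
theorem ncard_Vx_le (A : Finset (Fin 2 →₀ ℕ)) : (Vx A).ncard ≤ A.card :=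
  calc (Vx A).ncard ≤ (ι '' (A : Set (Fin 2 →₀ ℕ))).ncard :=
        Set.ncard_le_ncard extremePoints_convexHull_subset (Set.Finite.image ι (Finset.finite_toSet A))
    _ ≤ (A : Set (Fin 2 →₀ ℕ)).ncard := Set.ncard_image_le (Finset.finite_toSet A)
    _ = A.card := Set.ncard_coe_finset A

/-- `Newt(0)` has no vertices. [folklore] -/
theorem vert_zero : vert (0 : Poly) = 0 := by
  have h := ncard_Vx_le (0 : Poly).support
  rw [support_zero, Finset.card_empty] at h
  exact Nat.le_zero.1 h

/-- The splitting identity behind the recursion: `∏ f − ∏ g = f_i · W_i + (f_i − g_i) · S_i`. [folklore] -/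
theorem peel_identity {m : ℕ} (f g : Fin (m + 1) → Poly) (i : Fin (m + 1)) :
    ∏ j, f j - ∏ j, g j = f i * coarseDiff f g i + (f i - g i) * coarseProd g i := by
  rw [Fin.prod_univ_succAbove f i, Fin.prod_univ_succAbove g i, coarseDiff, coarseProd]
  ring

/-- The support of the difference lies in the peel frame (so `Newt(∏ f − ∏ g) ⊆ K_i`). [folklore] -/
theorem support_subset_peelFrame {m : ℕ} (f g : Fin (m + 1) → Poly) (i : Fin (m + 1)) :
    (∏ j, f j - ∏ j, g j).support ⊆ peelFrame f g i := by
  rw [peel_identity f g i, peelFrame]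
  exact support_add

/-- ONE SCALE STEP, accounting form: `vert(∏ f − ∏ g) ≤ #vert(K_i) + #hidden_i`. [folklore] -/
theorem vert_le_outer_add_hidden {m : ℕ} (f g : Fin (m + 1) → Poly) (i : Fin (m + 1)) :
    vert (∏ j, f j - ∏ j, g j) ≤ (Vx (peelFrame f g i)).ncard + hidden f g i := by
  have hsplit := Set.ncard_inter_add_ncard_sdiff_eq_ncard (Vx (∏ j, f j - ∏ j, g j).support)
    (Vx (peelFrame f g i)) (Vx_finite _)
  have hle : (Vx (∏ j, f j - ∏ j, g j).support ∩ Vx (peelFrame f g i)).ncard ≤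
      (Vx (peelFrame f g i)).ncard :=
    Set.ncard_le_ncard Set.inter_subset_right (Vx_finite _)
  change (Vx (∏ j, f j - ∏ j, g j).support).ncard ≤
    (Vx (peelFrame f g i)).ncard + (Vx (∏ j, f j - ∏ j, g j).support \ Vx (peelFrame f g i)).ncard
  omega

/-! ### Induction on scales -/

/-- INDUCTION ON SCALES: (α) (the landed `stub_outerVertices`) and the scale step (β) with constants `a, c` bound
`vert(∏ f − ∏ g)` by `F(2^a+1, t, c, m)`. [folklore] -/
theorem vert_le_F {a c : ℕ}
    (hβ : ∀ (m t : ℕ) (f g : Fin (m + 1) → Poly), (∀ j, (f j).support.card ≤ t) →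
      (∀ j, (g j).support.card ≤ t) →
        ∃ i : Fin (m + 1), hidden f g i ≤ 2 ^ a * vert (coarseDiff f g i) + (m + t + 2) ^ c) :
    ∀ (m t : ℕ) (f g : Fin m → Poly), (∀ j, (f j).support.card ≤ t) → (∀ j, (g j).support.card ≤ t) →
      vert (∏ j, f j - ∏ j, g j) ≤ F (2 ^ a + 1) t c m := by
  intro m
  induction m with
  | zero =>
    intro t f g _ _
    have h0 : (∏ j, f j - ∏ j, g j : Poly) = 0 := by simp
    rw [h0, vert_zero]
    exact Nat.zero_le _
  | succ m ih =>
    intro t f g hf hg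
    obtain ⟨i, hi⟩ := hβ m t f g hf hg
    have hK := stub_outerVertices m t f g i hf hg
    have hW : vert (coarseDiff f g i) ≤ F (2 ^ a + 1) t c m :=
      ih t (fun j => f (i.succAbove j)) (fun j => g (i.succAbove j)) (fun j => hf _) (fun j => hg _)
    calc vert (∏ j, f j - ∏ j, g j)
        ≤ (Vx (peelFrame f g i)).ncard + hidden f g i := vert_le_outer_add_hidden f g i
      _ ≤ (vert (coarseDiff f g i) + (m + 3) * t) + (2 ^ a * vert (coarseDiff f g i) + (m + t + 2) ^ c) :=
          add_le_add hK hi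
      _ = (2 ^ a + 1) * vert (coarseDiff f g i) + gterm t c m := by unfold gterm; ring
      _ ≤ (2 ^ a + 1) * F (2 ^ a + 1) t c m + gterm t c m := by gcongr
      _ = F (2 ^ a + 1) t c (m + 1) := rfl

/-- `g` is monotone in the scale index. [folklore] -/
theorem gterm_mono (t c k : ℕ) : gterm t c k ≤ gterm t c (k + 1) := by
  unfold gterm
  gcongr <;> omega

/-- Unrolling the recursion: `F(k) ≤ k·A^k·g(k)` for `A ≥ 1`. [folklore] -/
theorem F_le (A t c : ℕ) (hA : 1 ≤ A) : ∀ k, F A t c k ≤ k * A ^ k * gterm t c k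
  | 0 => by simp [F]
  | k + 1 => by
    have ih := F_le A t c hA k
    have hg := gterm_mono t c k
    have hAk : 1 ≤ A ^ (k + 1) := Nat.one_le_pow _ _ hA
    calc F A t c (k + 1) = A * F A t c k + gterm t c k := rfl
      _ ≤ A * (k * A ^ k * gterm t c k) + gterm t c k := by gcongr
      _ ≤ A * (k * A ^ k * gterm t c (k + 1)) + A ^ (k + 1) * gterm t c (k + 1) := by
          gcongr A * (k * A ^ k * ?_) + ?_
          calc gterm t c k ≤ gterm t c (k + 1) := hg
            _ = 1 * gterm t c (k + 1) := (one_mul _).symm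
            _ ≤ A ^ (k + 1) * gterm t c (k + 1) := Nat.mul_le_mul_right _ hAk
      _ = (k + 1) * A ^ (k + 1) * gterm t c (k + 1) := by ring

/-- The step term is polynomial: `g(m) ≤ (m+t+3)^(c+2)`. [folklore] -/
theorem gterm_le (t c m : ℕ) : gterm t c m ≤ (m + t + 3) ^ (c + 2) := by
  unfold gterm
  have h1 : 1 ≤ (m + t + 2) ^ c := Nat.one_le_pow _ _ (by omega)
  have h2 : (m + t + 2) ^ c ≤ (m + t + 3) ^ c := Nat.pow_le_pow_left (by omega) c
  have h3 : (m + 3) * t + 1 ≤ (m + t + 3) ^ 2 := by nlinarith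
  calc (m + 3) * t + (m + t + 2) ^ c
      ≤ (m + t + 2) ^ c * ((m + 3) * t) + (m + t + 2) ^ c := by
        nlinarith [Nat.mul_le_mul_right ((m + 3) * t) h1]
    _ = (m + t + 2) ^ c * ((m + 3) * t + 1) := by ring
    _ ≤ (m + t + 3) ^ c * (m + t + 3) ^ 2 := Nat.mul_le_mul h2 h3
    _ = (m + t + 3) ^ (c + 2) := by ring

/-- Closed form: `F(2^a+1, t, c, m) ≤ 2^((a+c+4)m)·(t+2)^(2c+4)`. [folklore] -/
theorem F_bound (a c t m : ℕ) : F (2 ^ a + 1) t c m ≤ 2 ^ ((a + c + 4) * m) * (t + 2) ^ (2 * c + 4) := by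
  have hA : 1 ≤ 2 ^ a + 1 := Nat.le_add_left 1 _
  have h1 : m ≤ 2 ^ m := Nat.lt_two_pow_self.le
  have h2 : (2 ^ a + 1) ^ m ≤ (2 ^ (a + 1)) ^ m := by
    apply Nat.pow_le_pow_left
    have := Nat.one_le_two_pow (n := a)
    rw [pow_succ]; omega
  have h3 : gterm t c m ≤ (2 ^ m) ^ (c + 2) * (t + 2) ^ (2 * (c + 2)) := by
    have hm : m + 1 ≤ 2 ^ m := Nat.lt_two_pow_self
    have ht : t + 3 ≤ (t + 2) ^ 2 := by nlinarith
    have hb : m + t + 3 ≤ 2 ^ m * (t + 2) ^ 2 :=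
      calc m + t + 3 ≤ (m + 1) * (t + 3) := by nlinarith
        _ ≤ 2 ^ m * (t + 2) ^ 2 := Nat.mul_le_mul hm ht
    calc gterm t c m ≤ (m + t + 3) ^ (c + 2) := gterm_le t c m
      _ ≤ (2 ^ m * (t + 2) ^ 2) ^ (c + 2) := Nat.pow_le_pow_left hb _
      _ = (2 ^ m) ^ (c + 2) * (t + 2) ^ (2 * (c + 2)) := by rw [mul_pow, ← pow_mul (t + 2) 2 (c + 2)]
  calc F (2 ^ a + 1) t c m ≤ m * (2 ^ a + 1) ^ m * gterm t c m := F_le _ _ _ hA m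
    _ ≤ 2 ^ m * (2 ^ (a + 1)) ^ m * ((2 ^ m) ^ (c + 2) * (t + 2) ^ (2 * (c + 2))) := by gcongr
    _ = 2 ^ ((a + c + 4) * m) * (t + 2) ^ (2 * c + 4) := by ring

/-- **The line `mahler-radix-recursion` closed modulo its scale step.**  If the weak multiplicative SCALE STEP
holds — for `t`-sparse `f, g : Fin (m+1) → ℂ[X,Y]` some factor pair `i` can be peeled with
`#hidden_i ≤ 2^a·vert(W_i) + (m+t+2)^c` (the hypothesis is the line's `HiddenVertices` / STUB (β) `stub_hiddenVertices`
VERBATIM; it is OPEN and NOT claimed here) — then the crux `TwoProducts` holds with `a' = a + c + 4`, `b' = 2c + 4`.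
STUB (α) enters as the landed theorem `stub_outerVertices`. [folklore] -/
theorem twoProducts_of_hiddenVertices
    (hβ : ∃ a c : ℕ, ∀ (m t : ℕ) (f g : Fin (m + 1) → Poly), (∀ j, (f j).support.card ≤ t) →
      (∀ j, (g j).support.card ≤ t) →
        ∃ i : Fin (m + 1), hidden f g i ≤ 2 ^ a * vert (coarseDiff f g i) + (m + t + 2) ^ c) :
    Summit.ValiantsHypothesis.ValiantsHypothesis.Theses.NewtonUnitEquations.TwoProducts := by
  obtain ⟨a, c, hβ⟩ := hβ
  refine ⟨a + c + 4, 2 * c + 4, fun m t f g hf hg => ?_⟩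
  exact (vert_le_F hβ m t f g hf hg).trans (F_bound a c t m)

/-! ### The radix regime: Mahler's functional equation and the regime theorem from the scale step (β_r) -/

/-- `vert` is invariant under `expand b` (`b ≠ 0`): the support is scaled by `b`, and a homothety of `ℝ²` maps
hull to hull and vertices to vertices. [folklore] -/
theorem vert_expand {b : ℕ} (hb : b ≠ 0) (W : Poly) : vert (expand b W) = vert W := by
  have hbR : (b : ℝ) ≠ 0 := by exact_mod_cast hb
  let L : (Fin 2 → ℝ) ≃ₗ[ℝ] (Fin 2 → ℝ) := LinearEquiv.smulOfNeZero ℝ (Fin 2 → ℝ) (b : ℝ) hbR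
  have hL : ∀ x : Fin 2 → ℝ, L x = (b : ℝ) • x := fun x => rfl
  have hι : ∀ e : Fin 2 →₀ ℕ, ι (b • e) = L (ι e) := by
    intro e
    rw [hL]
    ext i
    simp [ι]
  have himg : ι '' ((expand b W).support : Set (Fin 2 →₀ ℕ)) = L '' (ι '' (W.support : Set (Fin 2 →₀ ℕ))) := by
    rw [support_expand W hb, Finset.coe_image, Set.image_image, Set.image_image]
    exact Set.image_congr fun e _ => hι e
  show (Set.extremePoints ℝ (convexHull ℝ (ι '' ((expand b W).support : Set (Fin 2 →₀ ℕ))))).ncard =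
    (Set.extremePoints ℝ (convexHull ℝ (ι '' (W.support : Set (Fin 2 →₀ ℕ))))).ncard
  rw [himg, ← LinearEquiv.coe_toLinearMap, ← LinearMap.image_convexHull, LinearEquiv.coe_toLinearMap,
    ← image_extremePoints, Set.ncard_image_of_injective _ L.injective]

/-- MAHLER'S FUNCTIONAL EQUATION for the recursion: peeling the finest scale of a radix frame leaves `expand b` of the
radix frame of the shifted digits. [folklore] -/
theorem coarseDiff_radix_zero (b : ℕ) {m : ℕ} (D E : Fin (m + 1) → Poly) :
    coarseDiff (radix b D) (radix b E) 0 =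
      expand b (∏ j, radix b (fun j => D j.succ) j - ∏ j, radix b (fun j => E j.succ) j) := by
  simp only [coarseDiff, radix, Fin.zero_succAbove, Fin.val_succ, pow_succ', expand_mul, map_sub, map_prod]

/-- Hence the coarse vertex count of a radix frame is the vertex count of the shifted instance. [folklore] -/
theorem vert_coarseDiff_radix {b : ℕ} (hb : b ≠ 0) {m : ℕ} (D E : Fin (m + 1) → Poly) :
    vert (coarseDiff (radix b D) (radix b E) 0) =
      vert (∏ j, radix b (fun j => D j.succ) j - ∏ j, radix b (fun j => E j.succ) j) := by
  rw [coarseDiff_radix_zero, vert_expand hb]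

/-- INDUCTION ON SCALES in the radix regime (Mahler recursion: the coarse pair is the scaled shifted instance).
[folklore] -/
theorem vert_radix_le_H {κ : ℕ}
    (hβ : ∀ (b r m t : ℕ) (D E : Fin (m + 1) → Poly), 2 ≤ b → (∀ j, (D j).support.card ≤ t) →
      (∀ j, (E j).support.card ≤ t) → (∀ j, ∀ e ∈ (D j).support, ∀ l, e l < r * b) →
      (∀ j, ∀ e ∈ (E j).support, ∀ l, e l < r * b) →
        vert (∏ j, radix b D j - ∏ j, radix b E j) ≤
          vert (coarseDiff (radix b D) (radix b E) 0) + (m + 3) * t + (t + r + 2) ^ κ) :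
    ∀ (m b r t : ℕ) (D E : Fin m → Poly), 2 ≤ b → (∀ j, (D j).support.card ≤ t) →
      (∀ j, (E j).support.card ≤ t) → (∀ j, ∀ e ∈ (D j).support, ∀ l, e l < r * b) →
      (∀ j, ∀ e ∈ (E j).support, ∀ l, e l < r * b) →
        vert (∏ j, radix b D j - ∏ j, radix b E j) ≤ H t r κ m := by
  intro m
  induction m with
  | zero =>
    intro b r t D E _ _ _ _ _
    have h0 : (∏ j, radix b D j - ∏ j, radix b E j : Poly) = 0 := by simp
    rw [h0, vert_zero]
    exact Nat.zero_le _
  | succ m ih =>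
    intro b r t D E hb hD hE hDd hEd
    have hb0 : b ≠ 0 := by omega
    have hstep := hβ b r m t D E hb hD hE hDd hEd
    have hW : vert (coarseDiff (radix b D) (radix b E) 0) ≤ H t r κ m := by
      rw [vert_coarseDiff_radix hb0]
      exact ih b r t (fun j => D j.succ) (fun j => E j.succ) hb (fun j => hD _) (fun j => hE _)
        (fun j => hDd _) (fun j => hEd _)
    calc vert (∏ j, radix b D j - ∏ j, radix b E j)
        ≤ vert (coarseDiff (radix b D) (radix b E) 0) + (m + 3) * t + (t + r + 2) ^ κ := hstep
      _ ≤ H t r κ m + (m + 3) * t + (t + r + 2) ^ κ := by gcongr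
      _ = H t r κ (m + 1) := rfl

/-- Unrolling: `H(k) ≤ k·((k+2)t + (t+r+2)^κ)`. [folklore] -/
theorem H_le (t r κ : ℕ) : ∀ k, H t r κ k ≤ k * ((k + 2) * t + (t + r + 2) ^ κ)
  | 0 => by simp [H]
  | k + 1 => by
    have ih := H_le t r κ k
    calc H t r κ (k + 1) = H t r κ k + (k + 3) * t + (t + r + 2) ^ κ := rfl
      _ ≤ k * ((k + 2) * t + (t + r + 2) ^ κ) + (k + 3) * t + (t + r + 2) ^ κ := by omega
      _ ≤ (k + 1) * ((k + 3) * t + (t + r + 2) ^ κ) := by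
          nlinarith [Nat.zero_le (k * t), Nat.zero_le ((t + r + 2) ^ κ)]

/-- Absorbing two polynomial terms into one power. [folklore] -/
theorem absorb (Y κ A B : ℕ) (hY : 2 ≤ Y) (hA : A ≤ Y ^ 3) (hB : B ≤ Y ^ (κ + 1)) : A + B ≤ Y ^ (κ + 4) := by
  have h3 : Y ^ 3 ≤ Y ^ (κ + 3) := Nat.pow_le_pow_right (by omega) (by omega)
  have h4 : Y ^ (κ + 1) ≤ Y ^ (κ + 3) := Nat.pow_le_pow_right (by omega) (by omega)
  have h5 : 2 * Y ^ (κ + 3) ≤ Y ^ (κ + 4) :=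
    calc 2 * Y ^ (κ + 3) ≤ Y * Y ^ (κ + 3) := Nat.mul_le_mul_right _ hY
      _ = Y ^ (κ + 4) := by ring
  omega

/-- Closed form: `H(m) ≤ (m+t+r+2)^(κ+4)`. [folklore] -/
theorem H_bound (t r κ m : ℕ) : H t r κ m ≤ (m + t + r + 2) ^ (κ + 4) := by
  have h1 : m * ((m + 2) * t) ≤ (m + t + r + 2) ^ 3 :=
    calc m * ((m + 2) * t) ≤ (m + t + r + 2) * ((m + t + r + 2) * (m + t + r + 2)) := by
          gcongr <;> omega
      _ = (m + t + r + 2) ^ 3 := by ring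
  have h2 : m * (t + r + 2) ^ κ ≤ (m + t + r + 2) ^ (κ + 1) :=
    calc m * (t + r + 2) ^ κ ≤ (m + t + r + 2) * (m + t + r + 2) ^ κ :=
          Nat.mul_le_mul (by omega) (Nat.pow_le_pow_left (by omega) κ)
      _ = (m + t + r + 2) ^ (κ + 1) := by ring
  calc H t r κ m ≤ m * ((m + 2) * t + (t + r + 2) ^ κ) := H_le t r κ m
    _ = m * ((m + 2) * t) + m * (t + r + 2) ^ κ := by ring
    _ ≤ (m + t + r + 2) ^ (κ + 4) := absorb _ κ _ _ (by omega) h1 h2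

/-- **The radix regime theorem from the regime engine.**  If the additive per-scale increment of the radix regime
holds (the hypothesis is the line's `RadixScaleStep` / STUB (β_r) `stub_radixScaleStep` VERBATIM; OPEN, NOT claimed),
then `RadixTwoProducts` (the line's regime target, stated VERBATIM as the conclusion) holds with exponent `κ + 4`:
radix frames in base `b ≥ 2` with `t`-sparse digits of exponents `< r·b` on `m` scales have
`vert(∏_j D_j(X^{b^j},Y^{b^j}) − ∏_j E_j(X^{b^j},Y^{b^j})) ≤ (m + t + r + 2)^(κ+4)`. [folklore] -/
theorem radixTwoProducts_of_radixScaleStep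
    (hβ : ∃ κ : ℕ, ∀ (b r m t : ℕ) (D E : Fin (m + 1) → Poly), 2 ≤ b → (∀ j, (D j).support.card ≤ t) →
      (∀ j, (E j).support.card ≤ t) → (∀ j, ∀ e ∈ (D j).support, ∀ l, e l < r * b) →
      (∀ j, ∀ e ∈ (E j).support, ∀ l, e l < r * b) →
        vert (∏ j, radix b D j - ∏ j, radix b E j) ≤
          vert (coarseDiff (radix b D) (radix b E) 0) + (m + 3) * t + (t + r + 2) ^ κ) :
    ∃ κ : ℕ, ∀ (b r m t : ℕ) (D E : Fin m → Poly), 2 ≤ b → (∀ j, (D j).support.card ≤ t) →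
      (∀ j, (E j).support.card ≤ t) → (∀ j, ∀ e ∈ (D j).support, ∀ l, e l < r * b) →
      (∀ j, ∀ e ∈ (E j).support, ∀ l, e l < r * b) →
        vert (∏ j, radix b D j - ∏ j, radix b E j) ≤ (m + t + r + 2) ^ κ := by
  obtain ⟨κ, hβ⟩ := hβ
  refine ⟨κ + 4, fun b r m t D E hb hD hE hDd hEd => ?_⟩
  exact (vert_radix_le_H hβ m b r t D E hb hD hE hDd hEd).trans (H_bound t r κ m)

end Summit.ValiantsHypothesis.ValiantsHypothesis.Theorems.NewtonUnitEquations.TwoProducts.MahlerRadixRecursion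

end
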